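import Summits.ResolutionOfSingularities.ResolutionOfSingularities.Theorems.EquisingularLiftEquisingularLiftNatSpecimenQuarticLineStep
import Literature.AlgebraicGeometry.Resolution.PointBlowupAlgebraCharts
import Literature.AlgebraicGeometry.Resolution.MvPolynomialKillVars
import Mathlib.RingTheory.RegularLocalRing.Polynomial
import Mathlib.Algebra.MvPolynomial.Equiv
import Mathlib.Logic.Equiv.Option
import HarnessLib

/-!
# [OURS · L1 W4.5(b)] T-ISO-1 algebra layer, II: the POINT STEP of the quartic specimen `z² + x⁴ + y⁴`

Helper for the research stub `stub_elnat_three_isolated_nonabs` of the crux `EquisingularLiftNat`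
(stmt-ResolutionOfSingularities-20038; route `EquisingularLift`, chain w45b, CHAIN v7.1 §3 row
T-ISO-1; also the downstairs ∃-discharge of the quartic instance of res-L1-w45b-lead-2's rungs
T-Δ-ISO / T-ISO-0⁺). NOT a statement of any manuscript; AI-written kernel lemma of the cell
`res-hironaka` (weaker than expert review).

**Setting.** `A = k[x, y, z]` (`X 0, X 1, X 2`), `f = z² + x⁴ + y⁴` = the affine chart `x₃ = 1` (and, by
the symmetry `x₀ ↔ x₃`, the chart `x₀ = 1`) of `H = V(x₀²x₃² + x₁⁴ + x₂⁴)` at its singular point, `char k ≠ 2`.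
The point step blows up the origin `𝔪 = (x, y, z)` — the tree's `PointBlowup.Chart 2 k i = A[𝔪/Xᵢ]`
(`PointBlowupAlgebraCharts.lean`, with `polyEquiv : k[X_j/Xᵢ : j ≠ i][Xᵢ] ≅ A[𝔪/Xᵢ]`). On the three
charts `f = Xᵢ² · f′ᵢ`:

* `z`-chart: `f′ = 1 + z²((x/z)⁴ + (y/z)⁴)`; the Euler derivation `x∂ₓ + y∂_y` (kills `z`, preserves `𝔪`)
  extends to `A[𝔪/z]` with `x/z ↦ x/z`, `y/z ↦ y/z`, and takes `f′` to `4(f′ − 1) ≡ −4 (mod f′)`: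
  **`isRegularRing_pointChart₂`** — the chart ring `(A/(f))[𝔪̄/z̄]` is REGULAR (final);
* `x`-chart: `f′ = (z/x)² + x²(1 + (y/x)⁴)` is the LINE-STEP input `g = y₂² + y₁²(1 + y₀⁴)` of part I
  under `θ₀ : k[y₀,y₁,y₂] ≅ A[𝔪/x]`, `(y₀,y₁,y₂) ↦ (y/x, x, z/x)`:
  **`nonempty_pointChart₀_equiv`** — `(A/(f))[𝔪̄/x̄] ≅ k[y₀,y₁,y₂]/(g)` (GW 13.96 (2));
* `y`-chart: symmetrically **`nonempty_pointChart₁_equiv`** with `(y₀,y₁,y₂) ↦ (x/y, y, z/y)`.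

Together with part I (`…NatSpecimenQuarticLineStep.lean`: both charts of `Bl_ℓ V(g)` regular, the
charts `x₁ = 1`, `x₂ = 1` of `H` regular) this is the complete downstairs regularity discharge of the
4-step resolution «2 points + 2 in-carrier lines» of T-ISO-1 at RING level. Generic by-products:
`isQuasiRegular_X`, `isDomain_quotient_origin`, `prime_exc`, `isRegularRing_pointChart`,
`exists_ringEquiv_pointChart` (`k[T₀,T₁,T₂] ≅ A[𝔪/Xᵢ]`, `Tᵢ ↦ Xᵢ`, `T_j ↦ X_j/Xᵢ`).

NOT here: the `Proj`-level forms layer (F prime, `Sing H` = two points as a scheme statement) and the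
`ELNatAt` assembly (wait on R1-IN-CARRIER / the T-Δ-ISO frame, CHAIN v7.1 §3).

References: The Stacks Project, Tags 07PF, 0BIQ, 0804; Görtz–Wedhorn I, Prop. 13.96 (2); Eisenbud–Harris,
*3264 and All That*, §9.3.2 — through the cited tree files.
-/

set_option linter.dupNamespace false -- mandated namespace `Summit.<Summit>.<Problem>` of this single-conjunct summit

noncomputable section

open MvPolynomial IsLocalRing
open Literature.AlgebraicGeometry.Resolution

namespace Summit.ResolutionOfSingularities.ResolutionOfSingularities.Theorems.EquisingularLift.SpecimenQuartic

universe u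

variable (k : Type) [Field k]

/-! ## The origin of `𝔸³` as a blow-up centre -/

/-- The variables `(x, y, z)` form a quasi-regular sequence of `A = k[x,y,z]`. [folklore] -/
theorem isQuasiRegular_X : IsQuasiRegular (MvPolynomial.X : Fin 3 → MvPolynomial (Fin 3) k) := by
  apply isQuasiRegular_of_isWeaklyRegular
  have h := MvPolynomial.isWeaklyRegular_map_X (R := k) ([0, 1, 2] : List (Fin 3)) (by decide)
  have hl : List.ofFn (MvPolynomial.X : Fin 3 → MvPolynomial (Fin 3) k) =
      ([0, 1, 2] : List (Fin 3)).map (X : Fin 3 → MvPolynomial (Fin 3) k) := by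
    simp [List.ofFn_succ]
  rw [hl]
  exact h

/-- `A/(x, y, z) ≅ k` is a domain. [folklore] -/
theorem isDomain_quotient_origin : IsDomain (PointBlowup.R 2 k ⧸ PointBlowup.originIdeal 2 k) := by
  change IsDomain (MvPolynomial (Fin 3) k ⧸ Ideal.span (Set.range (X : Fin 3 → MvPolynomial (Fin 3) k)))
  rw [← Set.image_univ]
  exact MvPolynomial.isDomain_quotient_span_X Set.univ

/-- The exceptional equation `Xᵢ ∈ A[𝔪/Xᵢ]` is a prime element (Stacks 0BIQ: `A[𝔪/Xᵢ]/(Xᵢ) ≅ k[T_j : j ≠ i]`).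
[cite: StacksProject, Tag 0BIQ] -/
theorem prime_exc (i : Fin 3) : Prime (PointBlowup.exc 2 k i) := by
  haveI := isDomain_quotient_origin k
  have hP : (Ideal.span {PointBlowup.exc 2 k i}).IsPrime :=
    blowupAlgebra.isPrime_span_algebraMap (MvPolynomial.X : Fin 3 → MvPolynomial (Fin 3) k) i (isQuasiRegular_X k)
  haveI : Nontrivial (PointBlowup.Chart 2 k i) := (PointBlowup.polyEquiv 2 k i).injective.nontrivial
  have hne : PointBlowup.exc 2 k i ≠ 0 := nonZeroDivisors.ne_zero (PointBlowup.exc_mem_nonZeroDivisors 2 k i)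
  exact (Ideal.span_singleton_prime hne).mp hP

/-- The chart rings `A[𝔪/Xᵢ] ≅ k[X_j/Xᵢ : j ≠ i][Xᵢ]` are regular. [folklore; Eisenbud–Harris §9.3.2] -/
theorem isRegularRing_pointChart (i : Fin 3) : IsRegularRing (PointBlowup.Chart 2 k i) :=
  IsRegularRing.of_ringEquiv (PointBlowup.polyEquiv 2 k i)

/-- **`k[T₀, T₁, T₂] ≅ A[𝔪/Xᵢ]`, `Tᵢ ↦ Xᵢ`, `T_j ↦ X_j/Xᵢ` (`j ≠ i`)** — the tree's
`PointBlowup.polyEquiv` reindexed through `Fin 3 ≃ Unit ⊕ {j // j ≠ i}`. [folklore] -/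
theorem exists_ringEquiv_pointChart (i : Fin 3) :
    ∃ θ : MvPolynomial (Fin 3) k ≃+* PointBlowup.Chart 2 k i,
      θ (X i) = PointBlowup.exc 2 k i ∧ ∀ (j : Fin 3) (hj : j ≠ i), θ (X j) = PointBlowup.frac 2 k i j := by
  let e : Fin 3 ≃ Unit ⊕ {j : Fin 3 // j ≠ i} :=
    ((Equiv.optionSubtypeNe i).symm.trans (Equiv.optionEquivSumPUnit {j : Fin 3 // j ≠ i})).trans
      (Equiv.sumComm _ _)
  have hei : e i = Sum.inl () := by
    simp [e]
  have hej : ∀ (j : Fin 3) (hj : j ≠ i), e j = Sum.inr ⟨j, hj⟩ := by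
    intro j hj
    simp [e, Equiv.optionSubtypeNe_symm_of_ne hj]
  refine ⟨((renameEquiv k e).trans (sumAlgEquiv k Unit {j : Fin 3 // j ≠ i})).toRingEquiv.trans
    (PointBlowup.polyEquiv 2 k i), ?_, ?_⟩
  · simp [hei]
  · intro j hj
    simp [hej j hj]

/-! ## The specimen: `f = z² + x⁴ + y⁴` -/

/-- **`z`-chart of the point step: REGULAR.** `f = z²·f′`, `f′ = 1 + z²((x/z)⁴ + (y/z)⁴) = G₂(x/z, y/z)`; the
Euler derivation `x∂ₓ + y∂_y` extends to `A[𝔪/z]` and takes `f′` to `4(f′ − 1)`, which lies in no prime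
containing `f′` (`char k ≠ 2`); `z ∤ f′` (the constant coefficient `1` of `G₂` is outside `𝔪`); hence
`(A/(f))[𝔪̄/z̄] ≅ A[𝔪/z]/(f′)` is a regular ring. [OURS · T-ISO-1 algebra; Stacks 07PF, GW 13.96 (2)] -/
theorem isRegularRing_pointChart₂ (h2 : IsUnit (2 : k)) :
    IsRegularRing (blowupAlgebra ((PointBlowup.originIdeal 2 k).map
        (Ideal.Quotient.mk (Ideal.span {(X 2 ^ 2 + X 0 ^ 4 + X 1 ^ 4 : MvPolynomial (Fin 3) k)})))
      (Ideal.Quotient.mk (Ideal.span {(X 2 ^ 2 + X 0 ^ 4 + X 1 ^ 4 : MvPolynomial (Fin 3) k)}) (X 2))) := by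
  haveI := isRegularRing_pointChart k 2
  -- the chart polynomial `G₂ = 1 + C(z²)·(T₀⁴ + T₁⁴)`
  set G : MvPolynomial {j : Fin 3 // j ≠ 2} (MvPolynomial (Fin 3) k) :=
    1 + C (X 2 ^ 2) * (X ⟨0, by decide⟩ ^ 4 + X ⟨1, by decide⟩ ^ 4) with hG
  set u : PointBlowup.Chart 2 k 2 := PointBlowup.frac 2 k 2 0 with hu
  set v : PointBlowup.Chart 2 k 2 := PointBlowup.frac 2 k 2 1 with hv
  have hev : blowupAlgebra.eval (MvPolynomial.X : Fin 3 → MvPolynomial (Fin 3) k) 2 G =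
      1 + PointBlowup.exc 2 k 2 ^ 2 * (u ^ 4 + v ^ 4) := by
    rw [hG, map_add, map_one, map_mul, blowupAlgebra.eval_C, map_pow, map_add, map_pow, map_pow,
      blowupAlgebra.eval_X, blowupAlgebra.eval_X]
  -- `f = z² · f′` in `A[𝔪/z]`
  have hf : algebraMap (MvPolynomial (Fin 3) k) (PointBlowup.Chart 2 k 2) (X 2 ^ 2 + X 0 ^ 4 + X 1 ^ 4) =
      algebraMap (MvPolynomial (Fin 3) k) (PointBlowup.Chart 2 k 2) (X 2) ^ 2 *
        blowupAlgebra.eval (MvPolynomial.X : Fin 3 → MvPolynomial (Fin 3) k) 2 G := by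
    rw [hev, map_add, map_add, map_pow, map_pow, map_pow, PointBlowup.algebraMap_X 2 k 2 0,
      PointBlowup.algebraMap_X 2 k 2 1]
    ring
  -- `z ∤ f′`
  have hndvd : ¬ algebraMap (MvPolynomial (Fin 3) k) (PointBlowup.Chart 2 k 2) (X 2) ∣
      blowupAlgebra.eval (MvPolynomial.X : Fin 3 → MvPolynomial (Fin 3) k) 2 G := by
    intro h
    have hm := (blowupAlgebra.eval_mem_span_algebraMap_iff (MvPolynomial.X : Fin 3 → MvPolynomial (Fin 3) k) 2
      (isQuasiRegular_X k) G).mp (Ideal.mem_span_singleton.mpr h) 0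
    have hc : G.coeff 0 = 1 := by
      classical
      rw [hG, coeff_add, coeff_one, if_pos rfl, coeff_C_mul, coeff_add, coeff_X_pow, coeff_X_pow, if_neg, if_neg]
      · ring
      · intro h0
        have := congrArg (fun e : {j : Fin 3 // j ≠ 2} →₀ ℕ => e ⟨1, by decide⟩) h0
        simp at this
      · intro h0
        have := congrArg (fun e : {j : Fin 3 // j ≠ 2} →₀ ℕ => e ⟨0, by decide⟩) h0
        simp at this
    rw [hc] at hm
    haveI := isDomain_quotient_origin k
    exact ((Ideal.Quotient.isDomain_iff_prime _).mp inferInstance).ne_top ((Ideal.eq_top_iff_one _).mpr hm)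
  -- the Euler derivation and its plain extension
  set δ : Derivation k (MvPolynomial (Fin 3) k) (MvPolynomial (Fin 3) k) :=
    (X 0 : MvPolynomial (Fin 3) k) • (pderiv 0 : Derivation k (MvPolynomial (Fin 3) k) _) +
      (X 1 : MvPolynomial (Fin 3) k) • (pderiv 1 : Derivation k (MvPolynomial (Fin 3) k) _) with hδ
  have hδ0 : δ (X 0) = X 0 := by simp [δ]
  have hδ1 : δ (X 1) = X 1 := by simp [δ]
  have hδ2 : δ (X 2) = 0 := by simp [δ]
  have hδI : ∀ y ∈ PointBlowup.originIdeal 2 k, δ y ∈ PointBlowup.originIdeal 2 k := by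
    intro y hy
    refine Submodule.span_induction (p := fun y _ => δ y ∈ PointBlowup.originIdeal 2 k) ?_ ?_ ?_ ?_ hy
    · rintro _ ⟨j, rfl⟩
      fin_cases j
      · rw [show (X ((fun i => i) ⟨0, by norm_num⟩) : MvPolynomial (Fin 3) k) = X 0 from rfl, hδ0]
        exact blowupAlgebra.mem_span_range _ 0
      · rw [show (X ((fun i => i) ⟨1, by norm_num⟩) : MvPolynomial (Fin 3) k) = X 1 from rfl, hδ1]
        exact blowupAlgebra.mem_span_range _ 1
      · rw [show (X ((fun i => i) ⟨2, by norm_num⟩) : MvPolynomial (Fin 3) k) = X 2 from rfl, hδ2]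
        exact Ideal.zero_mem _
    · rw [map_zero]; exact Ideal.zero_mem _
    · intro a b _ _ ha hb
      rw [map_add]; exact Ideal.add_mem _ ha hb
    · intro c a ha hca
      rw [smul_eq_mul, Derivation.leibniz, smul_eq_mul, smul_eq_mul]
      exact Ideal.add_mem _ (Ideal.mul_mem_left _ _ hca) (Ideal.mul_mem_right _ _ ha)
  obtain ⟨D, hD, hDgen⟩ := exists_derivation_blowupAlgebra_of_apply_eq_zero
    (I := PointBlowup.originIdeal 2 k) (a := (X 2 : MvPolynomial (Fin 3) k)) k δ hδ2 hδI
  have hDu : D u = u := by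
    rw [hu, PointBlowup.frac, blowupAlgebra.frac, hDgen]
    apply Subtype.ext
    rw [blowupAlgebra.coe_gen, blowupAlgebra.coe_gen, hδ0]
  have hDv : D v = v := by
    rw [hv, PointBlowup.frac, blowupAlgebra.frac, hDgen]
    apply Subtype.ext
    rw [blowupAlgebra.coe_gen, blowupAlgebra.coe_gen, hδ1]
  have hDz : D (PointBlowup.exc 2 k 2) = 0 := by
    rw [PointBlowup.exc, hD, hδ2, map_zero]
  have hDval : D (1 + PointBlowup.exc 2 k 2 ^ 2 * (u ^ 4 + v ^ 4)) =
      4 * (PointBlowup.exc 2 k 2 ^ 2 * (u ^ 4 + v ^ 4)) := by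
    have e1 : D (PointBlowup.exc 2 k 2 ^ 2) = 0 := by
      rw [Derivation.leibniz_pow, hDz, smul_zero, smul_zero]
    have e2 : D (u ^ 4) = 4 * u ^ 4 := by
      rw [Derivation.leibniz_pow, hDu, show (4 - 1 : ℕ) = 3 from rfl]
      simp only [smul_eq_mul, nsmul_eq_mul, Nat.cast_ofNat]
      ring
    have e3 : D (v ^ 4) = 4 * v ^ 4 := by
      rw [Derivation.leibniz_pow, hDv, show (4 - 1 : ℕ) = 3 from rfl]
      simp only [smul_eq_mul, nsmul_eq_mul, Nat.cast_ofNat]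
      ring
    rw [map_add, Derivation.map_one_eq_zero, zero_add, Derivation.leibniz, e1, smul_zero, add_zero, map_add, e2, e3,
      smul_eq_mul]
    ring
  -- Stacks 07PF (local form) on `A[𝔪/z]`
  haveI hreg : IsRegularRing (PointBlowup.Chart 2 k 2 ⧸
      Ideal.span {blowupAlgebra.eval (MvPolynomial.X : Fin 3 → MvPolynomial (Fin 3) k) 2 G}) := by
    refine isRegularRing_quotient_of_derivations (S₀ := k) _ fun Q hQ hGQ => ⟨D, fun hDQ => ?_⟩
    rw [hev] at hGQ hDQ
    rw [hDval] at hDQ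
    have h2B : IsUnit (2 : PointBlowup.Chart 2 k 2) := isUnit_two_of k h2
    have hw : PointBlowup.exc 2 k 2 ^ 2 * (u ^ 4 + v ^ 4) ∈ Q := mem_of_four_mul_mem hQ h2B hDQ
    have h1 : (1 : PointBlowup.Chart 2 k 2) = (1 + PointBlowup.exc 2 k 2 ^ 2 * (u ^ 4 + v ^ 4)) -
        PointBlowup.exc 2 k 2 ^ 2 * (u ^ 4 + v ^ 4) := by ring
    have h1Q : (1 : PointBlowup.Chart 2 k 2) ∈ Q := by rw [h1]; exact Q.sub_mem hGQ hw
    exact hQ.ne_top ((Ideal.eq_top_iff_one _).mpr h1Q)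
  exact IsRegularRing.of_ringEquiv
    (R := PointBlowup.Chart 2 k 2 ⧸ Ideal.span {blowupAlgebra.eval (MvPolynomial.X : Fin 3 → MvPolynomial (Fin 3) k) 2 G})
    (blowupAlgebra.quotientKerMapQuotientEquiv _ _ hf (prime_exc k 2) hndvd)

/-- **`x`-chart of the point step ≅ the line-step input.** With `θ₀ : k[y₀,y₁,y₂] ≅ A[𝔪/x]`,
`(y₀, y₁, y₂) ↦ (y/x, x, z/x)`: `f = x²·θ₀(g)` for the LINE-STEP polynomial `g = y₂² + y₁²(1 + y₀⁴)` of
part I, `x ∤ θ₀(g)`, and hence `(A/(f))[𝔪̄/x̄] ≅ A[𝔪/x]/(θ₀ g) ≅ k[y₀,y₁,y₂]/(g)` (GW 13.96 (2)).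
[OURS · T-ISO-1 algebra; Stacks 0BIQ, GW 13.96 (2)] -/
theorem nonempty_pointChart₀_equiv :
    Nonempty ((MvPolynomial (Fin 3) k ⧸ Ideal.span {(X 2 ^ 2 + X 1 ^ 2 * (1 + X 0 ^ 4) : MvPolynomial (Fin 3) k)}) ≃+*
      blowupAlgebra ((PointBlowup.originIdeal 2 k).map
        (Ideal.Quotient.mk (Ideal.span {(X 2 ^ 2 + X 0 ^ 4 + X 1 ^ 4 : MvPolynomial (Fin 3) k)})))
      (Ideal.Quotient.mk (Ideal.span {(X 2 ^ 2 + X 0 ^ 4 + X 1 ^ 4 : MvPolynomial (Fin 3) k)}) (X 0))) := by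
  obtain ⟨θ, hθ0, hθj⟩ := exists_ringEquiv_pointChart k 0
  -- `θ₀ = θ ∘ (swap y₀ y₁)`: `y₀ ↦ y/x`, `y₁ ↦ x`, `y₂ ↦ z/x`
  set θ₀ : MvPolynomial (Fin 3) k ≃+* PointBlowup.Chart 2 k 0 :=
    (renameEquiv k (Equiv.swap (0 : Fin 3) 1)).toRingEquiv.trans θ with hθ₀
  have h0 : θ₀ (X 0) = PointBlowup.frac 2 k 0 1 := by
    simp [hθ₀, Equiv.swap_apply_left, hθj 1 (by decide)]
  have h1 : θ₀ (X 1) = PointBlowup.exc 2 k 0 := by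
    simp [hθ₀, Equiv.swap_apply_right, hθ0]
  have h2 : θ₀ (X 2) = PointBlowup.frac 2 k 0 2 := by
    simp [hθ₀, Equiv.swap_apply_of_ne_of_ne, hθj 2 (by decide)]
  -- the chart polynomial `G₀ = T₂² + C(x²)·(1 + T₁⁴)` and `θ₀ g = G₀(y/x, z/x)`
  set G : MvPolynomial {j : Fin 3 // j ≠ 0} (MvPolynomial (Fin 3) k) :=
    X ⟨2, by decide⟩ ^ 2 + C (X 0 ^ 2) * (1 + X ⟨1, by decide⟩ ^ 4) with hG
  have hev : blowupAlgebra.eval (MvPolynomial.X : Fin 3 → MvPolynomial (Fin 3) k) 0 G =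
      PointBlowup.frac 2 k 0 2 ^ 2 + PointBlowup.exc 2 k 0 ^ 2 * (1 + PointBlowup.frac 2 k 0 1 ^ 4) := by
    simp only [hG, map_add, map_pow, map_mul, map_one, blowupAlgebra.eval_X, blowupAlgebra.eval_C]
  have hθg : θ₀ (X 2 ^ 2 + X 1 ^ 2 * (1 + X 0 ^ 4)) =
      blowupAlgebra.eval (MvPolynomial.X : Fin 3 → MvPolynomial (Fin 3) k) 0 G := by
    rw [hev, map_add, map_pow, h2, map_mul, map_pow, h1, map_add, map_one, map_pow, h0]
  -- `f = x² · G₀(y/x, z/x)`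
  have hf : algebraMap (MvPolynomial (Fin 3) k) (PointBlowup.Chart 2 k 0) (X 2 ^ 2 + X 0 ^ 4 + X 1 ^ 4) =
      algebraMap (MvPolynomial (Fin 3) k) (PointBlowup.Chart 2 k 0) (X 0) ^ 2 *
        blowupAlgebra.eval (MvPolynomial.X : Fin 3 → MvPolynomial (Fin 3) k) 0 G := by
    rw [hev, map_add, map_add, map_pow, map_pow, map_pow, PointBlowup.algebraMap_X 2 k 0 2,
      PointBlowup.algebraMap_X 2 k 0 1]
    ring
  -- `x ∤ G₀(y/x, z/x)`: the coefficient of `T₂²` is `1 ∉ 𝔪`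
  have hndvd : ¬ algebraMap (MvPolynomial (Fin 3) k) (PointBlowup.Chart 2 k 0) (X 0) ∣
      blowupAlgebra.eval (MvPolynomial.X : Fin 3 → MvPolynomial (Fin 3) k) 0 G := by
    intro h
    have hm := (blowupAlgebra.eval_mem_span_algebraMap_iff (MvPolynomial.X : Fin 3 → MvPolynomial (Fin 3) k) 0
      (isQuasiRegular_X k) G).mp (Ideal.mem_span_singleton.mpr h) (Finsupp.single ⟨2, by decide⟩ 2)
    have hc : G.coeff (Finsupp.single ⟨2, by decide⟩ 2) = 1 := by
      classical
      rw [hG, coeff_add, coeff_X_pow, if_pos rfl, coeff_C_mul, coeff_add, coeff_one, coeff_X_pow, if_neg, if_neg]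
      · ring
      · intro h0
        have := congrArg (fun e : {j : Fin 3 // j ≠ 0} →₀ ℕ => e ⟨2, by decide⟩) h0
        simp at this
      · intro h0
        have := congrArg (fun e : {j : Fin 3 // j ≠ 0} →₀ ℕ => e ⟨2, by decide⟩) h0
        simp at this
    rw [hc] at hm
    haveI := isDomain_quotient_origin k
    exact ((Ideal.Quotient.isDomain_iff_prime _).mp inferInstance).ne_top ((Ideal.eq_top_iff_one _).mpr hm)
  -- assemble: `A/(g) ≅ A[𝔪/x]/(θ₀ g) = A[𝔪/x]/(G₀(…)) ≅ (A/(f))[𝔪̄/x̄]`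
  have hmap : Ideal.map θ₀ (Ideal.span {(X 2 ^ 2 + X 1 ^ 2 * (1 + X 0 ^ 4) : MvPolynomial (Fin 3) k)}) =
      Ideal.span {blowupAlgebra.eval (MvPolynomial.X : Fin 3 → MvPolynomial (Fin 3) k) 0 G} := by
    rw [Ideal.map_span, Set.image_singleton]
    exact congrArg _ (congrArg _ hθg)
  exact ⟨(Ideal.quotientEquiv _ _ θ₀ hmap.symm).trans
    (blowupAlgebra.quotientKerMapQuotientEquiv _ _ hf (prime_exc k 0) hndvd)⟩

/-- **`y`-chart of the point step ≅ the line-step input.** With `θ₁ : k[y₀,y₁,y₂] ≅ A[𝔪/y]`,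
`(y₀, y₁, y₂) ↦ (x/y, y, z/y)`: `f = y²·θ₁(g)` for the same `g = y₂² + y₁²(1 + y₀⁴)`, and
`(A/(f))[𝔪̄/ȳ] ≅ k[y₀,y₁,y₂]/(g)`. [OURS · T-ISO-1 algebra; Stacks 0BIQ, GW 13.96 (2)] -/
theorem nonempty_pointChart₁_equiv :
    Nonempty ((MvPolynomial (Fin 3) k ⧸ Ideal.span {(X 2 ^ 2 + X 1 ^ 2 * (1 + X 0 ^ 4) : MvPolynomial (Fin 3) k)}) ≃+*
      blowupAlgebra ((PointBlowup.originIdeal 2 k).map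
        (Ideal.Quotient.mk (Ideal.span {(X 2 ^ 2 + X 0 ^ 4 + X 1 ^ 4 : MvPolynomial (Fin 3) k)})))
      (Ideal.Quotient.mk (Ideal.span {(X 2 ^ 2 + X 0 ^ 4 + X 1 ^ 4 : MvPolynomial (Fin 3) k)}) (X 1))) := by
  obtain ⟨θ, hθ1, hθj⟩ := exists_ringEquiv_pointChart k 1
  have h0 : θ (X 0) = PointBlowup.frac 2 k 1 0 := hθj 0 (by decide)
  have h2 : θ (X 2) = PointBlowup.frac 2 k 1 2 := hθj 2 (by decide)
  set G : MvPolynomial {j : Fin 3 // j ≠ 1} (MvPolynomial (Fin 3) k) :=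
    X ⟨2, by decide⟩ ^ 2 + C (X 1 ^ 2) * (1 + X ⟨0, by decide⟩ ^ 4) with hG
  have hev : blowupAlgebra.eval (MvPolynomial.X : Fin 3 → MvPolynomial (Fin 3) k) 1 G =
      PointBlowup.frac 2 k 1 2 ^ 2 + PointBlowup.exc 2 k 1 ^ 2 * (1 + PointBlowup.frac 2 k 1 0 ^ 4) := by
    simp only [hG, map_add, map_pow, map_mul, map_one, blowupAlgebra.eval_X, blowupAlgebra.eval_C]
  have hθg : θ (X 2 ^ 2 + X 1 ^ 2 * (1 + X 0 ^ 4)) =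
      blowupAlgebra.eval (MvPolynomial.X : Fin 3 → MvPolynomial (Fin 3) k) 1 G := by
    rw [hev, map_add, map_pow, h2, map_mul, map_pow, hθ1, map_add, map_one, map_pow, h0]
  have hf : algebraMap (MvPolynomial (Fin 3) k) (PointBlowup.Chart 2 k 1) (X 2 ^ 2 + X 0 ^ 4 + X 1 ^ 4) =
      algebraMap (MvPolynomial (Fin 3) k) (PointBlowup.Chart 2 k 1) (X 1) ^ 2 *
        blowupAlgebra.eval (MvPolynomial.X : Fin 3 → MvPolynomial (Fin 3) k) 1 G := by
    rw [hev, map_add, map_add, map_pow, map_pow, map_pow, PointBlowup.algebraMap_X 2 k 1 2,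
      PointBlowup.algebraMap_X 2 k 1 0]
    ring
  have hndvd : ¬ algebraMap (MvPolynomial (Fin 3) k) (PointBlowup.Chart 2 k 1) (X 1) ∣
      blowupAlgebra.eval (MvPolynomial.X : Fin 3 → MvPolynomial (Fin 3) k) 1 G := by
    intro h
    have hm := (blowupAlgebra.eval_mem_span_algebraMap_iff (MvPolynomial.X : Fin 3 → MvPolynomial (Fin 3) k) 1
      (isQuasiRegular_X k) G).mp (Ideal.mem_span_singleton.mpr h) (Finsupp.single ⟨2, by decide⟩ 2)
    have hc : G.coeff (Finsupp.single ⟨2, by decide⟩ 2) = 1 := by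
      classical
      rw [hG, coeff_add, coeff_X_pow, if_pos rfl, coeff_C_mul, coeff_add, coeff_one, coeff_X_pow, if_neg, if_neg]
      · ring
      · intro h0
        have := congrArg (fun e : {j : Fin 3 // j ≠ 1} →₀ ℕ => e ⟨2, by decide⟩) h0
        simp at this
      · intro h0
        have := congrArg (fun e : {j : Fin 3 // j ≠ 1} →₀ ℕ => e ⟨2, by decide⟩) h0
        simp at this
    rw [hc] at hm
    haveI := isDomain_quotient_origin k
    exact ((Ideal.Quotient.isDomain_iff_prime _).mp inferInstance).ne_top ((Ideal.eq_top_iff_one _).mpr hm)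
  have hmap : Ideal.map θ (Ideal.span {(X 2 ^ 2 + X 1 ^ 2 * (1 + X 0 ^ 4) : MvPolynomial (Fin 3) k)}) =
      Ideal.span {blowupAlgebra.eval (MvPolynomial.X : Fin 3 → MvPolynomial (Fin 3) k) 1 G} := by
    rw [Ideal.map_span, Set.image_singleton]
    exact congrArg _ (congrArg _ hθg)
  exact ⟨(Ideal.quotientEquiv _ _ θ hmap.symm).trans
    (blowupAlgebra.quotientKerMapQuotientEquiv _ _ hf (prime_exc k 1) hndvd)⟩

end Summit.ResolutionOfSingularities.ResolutionOfSingularities.Theorems.EquisingularLift.SpecimenQuartic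

end
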